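import Mathlib

/-!
# `FeketeSOS.FeketeSOSHard` (stmt-ValiantsHypothesis-3996) — negative side: the dissociated cube and its
# tensor-power dual witness (combinatorics)

Part 1 of the refutation of the registered stub `stub_tameOperator` of the line
`Cruxes/FeketeSOSHard/Lines/paley_rip_v3.lean` (operator tameness `T(r,m)` with exponent `1+ε`), by the seat
val-width-3996-p5 (g3).  Objects enter as HYPOTHESES (the line's definition-free idiom): a set family
`S : ℕ → Finset ℕ` with `S 0 = {0}`, `S (J+1) = {3^J e + σ : e < 2, σ ∈ S J}` — the dissociated cube
`{Σ_{i∈A} 3^i : A ⊆ [0,J)}`, `#S J = 2^J`, digits never carry (`2s < 3^J`); digit weights `ζ = (2, 1, −2, 0, 0, …)`;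
and the dual witness `z : ℕ → ℕ → ℝ`, `z 0 = δ_0`, `z (J+1) n = ζ(n / 3^J) · z J (n % 3^J)`, i.e.
`z(Σ_i ν_i 3^i) = Π_i ζ(ν_i)` on digit vectors.  Main result `cube_orth`: the ORTHOGONALITY
`Σ_{t ∈ S J} z(s+t) z(s'+t) = 5^J · [s = s']` for `s, s' ∈ S J` — the restricted Hankel matrix `(z(s+t))_{s,t ∈ S J}` is
`√5^J` times an isometry (the `J`-th Kronecker power of `[[2,1],[1,−2]]`, whose square is `5·I`).

Parts 2–3 (`…Negative/TameOperatorCubePattern.lean`, `…Negative/TameOperatorFalse.lean`) build the rank-2 pattern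
`Π_i (1 + X^{3^i} − X^{2·3^i})` and derive the mass floor `5^{J/2} = m^{log₂ √5}` contradicting the stub.
Elementary; no facts, no definitions. [folklore]  Honest framing: kills a STUB of one line; the crux `FeketeSOSHard`,
the engine `stub_paleyFlatRIP` and `VP ≠ VNP` are untouched.
-/

-- `Summit.ValiantsHypothesis.ValiantsHypothesis.…` is the tree's namespace convention (summit = problem here).
set_option linter.dupNamespace false

namespace Summit.ValiantsHypothesis.ValiantsHypothesis.Theorems.FeketeSOSHard.Negative

open Finset
open scoped BigOperators

noncomputable section

/-! ## Digits: uniqueness of `N·e + σ` (`σ < N`) and block sums -/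

/-- Division with remainder is unique: `N e + σ = N e' + σ'` with `σ, σ' < N` forces `e = e'`, `σ = σ'`. [folklore] -/
theorem digit_inj {N e σ e' σ' : ℕ} (hσ : σ < N) (hσ' : σ' < N) (h : N * e + σ = N * e' + σ') :
    e = e' ∧ σ = σ' := by
  have hN : 0 < N := by omega
  have h1 : (N * e + σ) / N = e := by rw [Nat.mul_add_div hN, Nat.div_eq_of_lt hσ, add_zero]
  have h1' : (N * e' + σ') / N = e' := by rw [Nat.mul_add_div hN, Nat.div_eq_of_lt hσ', add_zero]
  have h2 : (N * e + σ) % N = σ := by rw [Nat.mul_add_mod, Nat.mod_eq_of_lt hσ]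
  have h2' : (N * e' + σ') % N = σ' := by rw [Nat.mul_add_mod, Nat.mod_eq_of_lt hσ']
  refine ⟨?_, ?_⟩
  · rw [← h1, ← h1', h]
  · rw [← h2, ← h2', h]

/-- Splitting a sum over `range (N * b)` into `b` blocks of length `N`. [folklore] -/
theorem sum_range_mul_blocks {M : Type*} [AddCommMonoid M] (N : ℕ) (f : ℕ → M) :
    ∀ b : ℕ, ∑ n ∈ range (N * b), f n = ∑ e ∈ range b, ∑ σ ∈ range N, f (N * e + σ)
  | 0 => by simp
  | b + 1 => by
    rw [mul_add_one, sum_range_add, sum_range_mul_blocks N f b, sum_range_succ]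

/-! ## The dissociated cube (as a hypothesis on `S : ℕ → Finset ℕ`) -/

section Cube

variable (S : ℕ → Finset ℕ)

/-- Membership in `S (J+1)`: a top digit `e < 2` over an element of `S J`. [folklore] -/
theorem mem_cube_succ (hS : ∀ J, S (J + 1) = (range 2 ×ˢ S J).image fun q => 3 ^ J * q.1 + q.2)
    {J s : ℕ} : s ∈ S (J + 1) ↔ ∃ e, e < 2 ∧ ∃ σ, σ ∈ S J ∧ s = 3 ^ J * e + σ := by
  rw [hS, mem_image]
  constructor
  · rintro ⟨⟨e, σ⟩, hq, rfl⟩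
    rw [mem_product, mem_range] at hq
    exact ⟨e, hq.1, σ, hq.2, rfl⟩
  · rintro ⟨e, he, σ, hσ, rfl⟩
    exact ⟨(e, σ), mem_product.2 ⟨mem_range.2 he, hσ⟩, rfl⟩

/-- Digits never carry: every `s ∈ S J` has `2s < 3^J`. [folklore] -/
theorem two_mul_lt_of_mem_cube (hS0 : S 0 = {0})
    (hS : ∀ J, S (J + 1) = (range 2 ×ˢ S J).image fun q => 3 ^ J * q.1 + q.2) :
    ∀ {J s : ℕ}, s ∈ S J → 2 * s < 3 ^ J
  | 0, s, hs => by
    rw [hS0, mem_singleton] at hs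
    subst hs; norm_num
  | J + 1, s, hs => by
    obtain ⟨e, he, σ, hσ, rfl⟩ := (mem_cube_succ S hS).1 hs
    have ih := two_mul_lt_of_mem_cube hS0 hS hσ
    have h3 : (3 : ℕ) ^ (J + 1) = 3 ^ J * 3 := pow_succ 3 J
    rw [h3]
    have : 3 ^ J * e ≤ 3 ^ J * 1 := Nat.mul_le_mul_left _ (by omega)
    nlinarith

/-- Every element of `S J` is `< 3^J`. [folklore] -/
theorem lt_of_mem_cube (hS0 : S 0 = {0})
    (hS : ∀ J, S (J + 1) = (range 2 ×ˢ S J).image fun q => 3 ^ J * q.1 + q.2)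
    {J s : ℕ} (hs : s ∈ S J) : s < 3 ^ J := by
  have := two_mul_lt_of_mem_cube S hS0 hS hs; omega

/-- Sums of two elements of `S J` stay `< 3^J`. [folklore] -/
theorem add_lt_of_mem_cube (hS0 : S 0 = {0})
    (hS : ∀ J, S (J + 1) = (range 2 ×ˢ S J).image fun q => 3 ^ J * q.1 + q.2)
    {J s t : ℕ} (hs : s ∈ S J) (ht : t ∈ S J) : s + t < 3 ^ J := by
  have := two_mul_lt_of_mem_cube S hS0 hS hs; have := two_mul_lt_of_mem_cube S hS0 hS ht; omega

/-- `S J ⊂ [0, p)` as soon as `3^J ≤ p`. [folklore] -/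
theorem mem_cube_lt_of_le (hS0 : S 0 = {0})
    (hS : ∀ J, S (J + 1) = (range 2 ×ˢ S J).image fun q => 3 ^ J * q.1 + q.2)
    {J p : ℕ} (hp : 3 ^ J ≤ p) : ∀ a ∈ S J, a < p :=
  fun _ ha => lt_of_lt_of_le (lt_of_mem_cube S hS0 hS ha) hp

/-- The digit map `(e, σ) ↦ 3^J e + σ` is injective on `range 2 × S J`. [folklore] -/
theorem cube_injOn (hS0 : S 0 = {0})
    (hS : ∀ J, S (J + 1) = (range 2 ×ˢ S J).image fun q => 3 ^ J * q.1 + q.2) (J : ℕ) :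
    Set.InjOn (fun q : ℕ × ℕ => 3 ^ J * q.1 + q.2) ↑(range 2 ×ˢ S J) := by
  rintro ⟨e, σ⟩ hq ⟨e', σ'⟩ hq' h
  simp only [coe_product, Set.mem_prod, mem_coe, mem_range] at hq hq'
  have h' : 3 ^ J * e + σ = 3 ^ J * e' + σ' := by simpa using h
  obtain ⟨rfl, rfl⟩ := digit_inj (lt_of_mem_cube S hS0 hS hq.2) (lt_of_mem_cube S hS0 hS hq'.2) h'
  rfl

/-- `#S J = 2^J`. [folklore] -/
theorem card_cube (hS0 : S 0 = {0})
    (hS : ∀ J, S (J + 1) = (range 2 ×ˢ S J).image fun q => 3 ^ J * q.1 + q.2) :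
    ∀ J : ℕ, (S J).card = 2 ^ J
  | 0 => by simp [hS0]
  | J + 1 => by
    rw [hS, card_image_of_injOn (cube_injOn S hS0 hS J), card_product, card_range, card_cube hS0 hS J,
      pow_succ, mul_comm]

/-- Sums over `S (J+1)` split along the top digit. [folklore] -/
theorem sum_cube_succ (hS0 : S 0 = {0})
    (hS : ∀ J, S (J + 1) = (range 2 ×ˢ S J).image fun q => 3 ^ J * q.1 + q.2)
    {M : Type*} [AddCommMonoid M] (J : ℕ) (f : ℕ → M) :
    ∑ s ∈ S (J + 1), f s = ∑ e ∈ range 2, ∑ σ ∈ S J, f (3 ^ J * e + σ) := by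
  rw [hS, sum_image (cube_injOn S hS0 hS J), sum_product]

end Cube

/-! ## The dual witness `z` (as a hypothesis) and its orthogonality -/

section Dual

variable (ζ : ℕ → ℝ) (z : ℕ → ℕ → ℝ)

/-- `z J` vanishes off `[0, 3^J)`. [folklore] -/
theorem cubeZ_eq_zero (hζ : ζ 0 = 2 ∧ ζ 1 = 1 ∧ ζ 2 = -2 ∧ ∀ e, 3 ≤ e → ζ e = 0)
    (hz0 : ∀ n, z 0 n = if n = 0 then 1 else 0) (hz : ∀ J n, z (J + 1) n = ζ (n / 3 ^ J) * z J (n % 3 ^ J)) :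
    ∀ {J n : ℕ}, 3 ^ J ≤ n → z J n = 0
  | 0, n, hn => by
    rw [hz0, if_neg]; simp at hn; omega
  | J + 1, n, hn => by
    rw [hz]
    have h3 : 3 ≤ n / 3 ^ J := by
      rw [Nat.le_div_iff_mul_le (pow_pos (by norm_num) J)]
      rw [pow_succ] at hn; linarith
    rw [hζ.2.2.2 _ h3, zero_mul]

/-- The recursion of `z` on a digit expansion. [folklore] -/
theorem cubeZ_succ_apply (hz : ∀ J n, z (J + 1) n = ζ (n / 3 ^ J) * z J (n % 3 ^ J))
    (J e σ : ℕ) (hσ : σ < 3 ^ J) : z (J + 1) (3 ^ J * e + σ) = ζ e * z J σ := by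
  have hN : 0 < 3 ^ J := pow_pos (by norm_num) J
  rw [hz, Nat.mul_add_div hN, Nat.div_eq_of_lt hσ, add_zero, Nat.mul_add_mod, Nat.mod_eq_of_lt hσ]

/-- The one-digit orthogonality: `Σ_{d<2} ζ(e+d) ζ(e'+d) = 5 · [e = e']` for `e, e' < 2`
(`[[2,1],[1,−2]]² = 5·I`). [folklore] -/
theorem zeta_orth (hζ : ζ 0 = 2 ∧ ζ 1 = 1 ∧ ζ 2 = -2 ∧ ∀ e, 3 ≤ e → ζ e = 0)
    (e e' : ℕ) (he : e < 2) (he' : e' < 2) :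
    ∑ d ∈ range 2, ζ (e + d) * ζ (e' + d) = if e = e' then 5 else 0 := by
  obtain ⟨h0, h1, h2, -⟩ := hζ
  interval_cases e <;> interval_cases e' <;> simp [sum_range_succ, h0, h1, h2] <;> norm_num

/-- **Orthogonality of the dual witness.**  For `s, s' ∈ S J`:
`Σ_{t ∈ S J} z(s+t) · z(s'+t) = 5^J · [s = s']` — the restricted Hankel matrix `(z(s+t))_{s,t ∈ S J}` is `√5^J`
times an isometry. [folklore] -/
theorem cube_orth (S : ℕ → Finset ℕ) (hS0 : S 0 = {0})
    (hS : ∀ J, S (J + 1) = (range 2 ×ˢ S J).image fun q => 3 ^ J * q.1 + q.2)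
    (hζ : ζ 0 = 2 ∧ ζ 1 = 1 ∧ ζ 2 = -2 ∧ ∀ e, 3 ≤ e → ζ e = 0)
    (hz0 : ∀ n, z 0 n = if n = 0 then 1 else 0) (hz : ∀ J n, z (J + 1) n = ζ (n / 3 ^ J) * z J (n % 3 ^ J)) :
    ∀ (J : ℕ) {s s' : ℕ}, s ∈ S J → s' ∈ S J →
      ∑ t ∈ S J, z J (s + t) * z J (s' + t) = if s = s' then (5 : ℝ) ^ J else 0
  | 0, s, s', hs, hs' => by
    rw [hS0, mem_singleton] at hs hs'
    subst hs; subst hs'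
    simp [hS0, hz0]
  | J + 1, s, s', hs, hs' => by
    obtain ⟨e, he, σ, hσ, rfl⟩ := (mem_cube_succ S hS).1 hs
    obtain ⟨e', he', σ', hσ', rfl⟩ := (mem_cube_succ S hS).1 hs'
    rw [sum_cube_succ S hS0 hS]
    have hlt := fun {a b : ℕ} (ha : a ∈ S J) (hb : b ∈ S J) => add_lt_of_mem_cube S hS0 hS ha hb
    calc ∑ d ∈ range 2, ∑ θ ∈ S J,
          z (J + 1) (3 ^ J * e + σ + (3 ^ J * d + θ)) * z (J + 1) (3 ^ J * e' + σ' + (3 ^ J * d + θ))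
        = ∑ d ∈ range 2, ∑ θ ∈ S J, (ζ (e + d) * ζ (e' + d)) * (z J (σ + θ) * z J (σ' + θ)) := by
          refine sum_congr rfl fun d _ => sum_congr rfl fun θ hθ => ?_
          have h1 : 3 ^ J * e + σ + (3 ^ J * d + θ) = 3 ^ J * (e + d) + (σ + θ) := by ring
          have h2 : 3 ^ J * e' + σ' + (3 ^ J * d + θ) = 3 ^ J * (e' + d) + (σ' + θ) := by ring
          rw [h1, h2, cubeZ_succ_apply ζ z hz _ _ _ (hlt hσ hθ), cubeZ_succ_apply ζ z hz _ _ _ (hlt hσ' hθ)]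
          ring
      _ = (∑ d ∈ range 2, ζ (e + d) * ζ (e' + d)) * ∑ θ ∈ S J, z J (σ + θ) * z J (σ' + θ) := by
          rw [sum_mul_sum]
      _ = (if e = e' then (5 : ℝ) else 0) * (if σ = σ' then (5 : ℝ) ^ J else 0) := by
          rw [zeta_orth ζ hζ e e' he he', cube_orth S hS0 hS hζ hz0 hz J hσ hσ']
      _ = if 3 ^ J * e + σ = 3 ^ J * e' + σ' then (5 : ℝ) ^ (J + 1) else 0 := by
          have hσN := lt_of_mem_cube S hS0 hS hσ
          have hσN' := lt_of_mem_cube S hS0 hS hσ'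
          by_cases hee : e = e'
          · by_cases hss : σ = σ'
            · subst hee; subst hss; simp [pow_succ, mul_comm]
            · rw [if_pos hee, if_neg hss, mul_zero, if_neg]
              exact fun h => hss (digit_inj hσN hσN' h).2
          · rw [if_neg hee, zero_mul, if_neg]
            exact fun h => hee (digit_inj hσN hσN' h).1

end Dual

end

end Summit.ValiantsHypothesis.ValiantsHypothesis.Theorems.FeketeSOSHard.Negative
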